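import Summits.ResolutionOfSingularities.ResolutionOfSingularities.Theorems.PurelyInseparableDim4IsolationCurveWitness
import HarnessLib

/-!
# [OURS · res-dim4-pi PR-10, part 4] BLINDNESS certificates: `¬ InCoordinateScope q F` from one
  non-coordinate prime through the origin — kernel / line / branch forms — and the cell's three named
  blind specimens (T-001 = TRAP-1, T-002 = F₃, idea-3's T-ISO-1 polynomial) ‖ K

Cell `res-dim4-pi` (D-0157 DOOR 2), PR-10 (WORD #24 (a)) fourth file, seat `res-dim4-p-3`; sequel of
`PurelyInseparableDim4IsolationWitness.lean` / `…IsolationCurveWitness.lean`.  The frame's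
`PIDim4.InCoordinateScope q F` (Scope add-on, WORD #20): every minimal prime of `J_q⁺(F)` inside `𝔪₀` is a
coordinate ideal `(x_S)` — the regime where a coordinate centre rule is NOT a restriction of Hironaka's
player A.  EN-9 (WORD #25 (c)) finds the opposite («BLIND») at every off-spine literal cycle: a regular
NON-coordinate component of `Sing_q` through `0`.  This file is the kernel tool for certifying blindness
of a state: name ONE prime `P` with `J_q⁺(F) ≤ P ≤ 𝔪₀` such that no coordinate ideal `(x_S)` fits between
`J_q⁺(F)` and `P`; then the minimal prime of `J_q⁺(F)` below `P` is inside `𝔪₀` and not coordinate.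

## What is proved (field `K`)

* `span_X_image_le_iff`: `(x_S) ≤ P ↔ ∀ i ∈ S, xᵢ ∈ P` (bookkeeping).
* **`not_inCoordinateScope_of_prime`**: `P` prime, `J_q⁺(F) ≤ P ≤ 𝔪₀`, a set `V ⊇ {i : xᵢ ∈ P}` with
  `¬ J_q⁺(F) ≤ (x_V)` ⇒ `¬ InCoordinateScope q F`.
* `not_le_span_X_image_of_eval`: `¬ J_q⁺(F) ≤ (x_V)` from ONE Hasse derivative `D^{(α)}F`
  (`0 < |α| < q`) not vanishing at a point `a` with `aᵢ = 0` (`i ∈ V`).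
* **`not_inCoordinateScope_of_ringHom`**: kernel form — `φ : K[x] → B` (domain) killing the `D^{(α)}F`,
  `ker φ ≤ 𝔪₀`, `φ(xᵢ) ≠ 0` off `V`, and a `D^{(α)}F` non-zero at a point `a` with `a|_V = 0`.
* `not_inCoordinateScope_two_of_line` / `not_inCoordinateScope_two_of_powerSeriesCurve`: the `q = 2`
  line and branch conveniences (partials, `singLocusIdeal_two`).
* Specimens (all over EVERY field; the characteristic-`2` reading is the cell's):
  **`not_inCoordinateScope_two_trap1`** (T-001, branch `x₂ = t, x₄ = −t(1+t)⁻¹, x₁ = x₃ = 0`; `V = {x₁, x₃}`;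
  `∂₃F = x₄ + x₂ + x₂x₄ ≠ 0` at `(0,0,0,1)`), **`not_inCoordinateScope_two_trapF3`** (T-002 = F₃, branch
  `x₁ = x₂ = t, x₃ = 0, x₄ = −t(1+t)⁻¹`; `V = {x₃}`), **`not_inCoordinateScope_two_idea3Specimen`** (line
  `(t,t,t,0)`, `V = {x₄}`, `∂₁F = x₂ + x₃ ≠ 0` at `(0,1,0,0)`) — K-S2-1's mechanism «coordinate blindness»
  as three kernel facts in the Scope vocabulary.

[OURS · counted 0 · elementary; AI kernel work, weaker than expert review.]  Nothing here is a statement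
about resolution of singularities; resolution in dimension `≥ 4` / characteristic `p > 0` is NOT proved by
anything in this file.  Host item (DR-157-C): `stmt-ResolutionOfSingularities-16155`, helper.
-/

noncomputable section

set_option linter.dupNamespace false -- mandated namespace of this single-conjunct summit

open MvPolynomial Finset
open scoped BigOperators

namespace Summit.ResolutionOfSingularities.ResolutionOfSingularities.Theorems.PIDim4.IsolationCert

/-! ## §1 One non-coordinate prime refutes `InCoordinateScope` -/

/-- `(x_S) ≤ P` iff every `xᵢ`, `i ∈ S`, lies in `P`. OURS (bookkeeping).
[cite: AtiyahMacdonald1969, Ch. 1 Ex. 1.1 (the ideal (x₁,…,xₙ))] -/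
theorem span_X_image_le_iff {K : Type} [Field K] (S : Finset (Fin 4))
    (P : Ideal (MvPolynomial (Fin 4) K)) :
    Ideal.span ((fun i => (X i : MvPolynomial (Fin 4) K)) '' (S : Set (Fin 4))) ≤ P ↔
      ∀ i ∈ S, (X i : MvPolynomial (Fin 4) K) ∈ P := by
  rw [Ideal.span_le]
  constructor
  · intro h i hi
    exact h ⟨i, hi, rfl⟩
  · rintro h _ ⟨i, hi, rfl⟩
    exact h i hi

/-- **Blindness from one prime.** Let `P` be a prime with `J_q⁺(F) ≤ P ≤ 𝔪₀`, and `V` a set of variables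
containing every `xᵢ ∈ P`. If `J_q⁺(F)` is NOT contained in the coordinate ideal `(x_V)`, then some minimal
prime of `J_q⁺(F)` inside `𝔪₀` is not a coordinate ideal: `¬ InCoordinateScope q F`. (A coordinate ideal
`(x_S)` between `J_q⁺(F)` and `P` would have `S ⊆ V`.) OURS (elementary).
[cite: AtiyahMacdonald1969, Ch. 1 (prime ideals; minimal primes, Ex. 1.8)] -/
theorem not_inCoordinateScope_of_prime {K : Type} [Field K] {q : ℕ} {F : MvPolynomial (Fin 4) K}
    {P : Ideal (MvPolynomial (Fin 4) K)} (hP : P.IsPrime) (hJP : singLocusIdeal q F ≤ P)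
    (hPm : P ≤ originIdeal K) (V : Finset (Fin 4))
    (hV : ∀ i : Fin 4, (X i : MvPolynomial (Fin 4) K) ∈ P → i ∈ V)
    (hJV : ¬ singLocusIdeal q F ≤
      Ideal.span ((fun i => (X i : MvPolynomial (Fin 4) K)) '' (V : Set (Fin 4)))) :
    ¬ InCoordinateScope q F := by
  intro hscope
  haveI := hP
  obtain ⟨P', hP', hP'P⟩ := Ideal.exists_minimalPrimes_le hJP
  obtain ⟨S, hS⟩ := hscope P' hP' (hP'P.trans hPm)
  apply hJV
  have hJS : singLocusIdeal q F ≤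
      Ideal.span ((fun i => (X i : MvPolynomial (Fin 4) K)) '' (S : Set (Fin 4))) := hS ▸ hP'.1.2
  refine hJS.trans (Ideal.span_mono (Set.image_mono fun i hi => ?_))
  have hXi : (X i : MvPolynomial (Fin 4) K) ∈ P :=
    hP'P (hS ▸ Ideal.subset_span ⟨i, hi, rfl⟩)
  exact hV i hXi

/-- **The escaping generator.** `¬ J_q⁺(F) ≤ (x_V)` as soon as ONE Hasse derivative `D^{(α)}F`
(`0 < |α| < q`) does not vanish at some point `a` with `aᵢ = 0` for all `i ∈ V` (every element of `(x_V)`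
vanishes there). OURS (elementary). [cite: Giraud1975, §1 (Hasse–Schmidt derivations)] -/
theorem not_le_span_X_image_of_eval {K : Type} [Field K] {q : ℕ} {F : MvPolynomial (Fin 4) K}
    (V : Finset (Fin 4)) (α : Fin 4 →₀ ℕ) (h0 : 0 < α.degree) (hq : α.degree < q) (a : Fin 4 → K)
    (haV : ∀ i ∈ V, a i = 0) (hne : MvPolynomial.eval a (hasseDeriv α F) ≠ 0) :
    ¬ singLocusIdeal q F ≤
      Ideal.span ((fun i => (X i : MvPolynomial (Fin 4) K)) '' (V : Set (Fin 4))) := by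
  intro hle
  have hmem : hasseDeriv α F ∈
      Ideal.span ((fun i => (X i : MvPolynomial (Fin 4) K)) '' (V : Set (Fin 4))) :=
    hle (Ideal.subset_span ⟨α, h0, hq, rfl⟩)
  have hker : Ideal.span ((fun i => (X i : MvPolynomial (Fin 4) K)) '' (V : Set (Fin 4))) ≤
      RingHom.ker (MvPolynomial.eval a) := by
    rw [Ideal.span_le]
    rintro _ ⟨i, hi, rfl⟩
    rw [SetLike.mem_coe, RingHom.mem_ker, eval_X]
    exact haV i hi
  exact hne ((RingHom.mem_ker).mp (hker hmem))

/-- **Kernel form of the blindness certificate.** A ring map `φ : K[x₁..x₄] → B` to a domain with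
`φ(D^{(α)}F) = 0` (`0 < |α| < q`), `ker φ ≤ 𝔪₀` (`φ g = 0 ⇒ g(0) = 0`), `φ(xᵢ) ≠ 0` for `i ∉ V`, and one
`D^{(α)}F` not vanishing at a point `a` with `a|_V = 0`, certifies `¬ InCoordinateScope q F`. OURS (elementary).
[cite: AtiyahMacdonald1969, Ch. 1 (prime ideals)] -/
theorem not_inCoordinateScope_of_ringHom {K : Type} [Field K] {q : ℕ} {F : MvPolynomial (Fin 4) K}
    {B : Type*} [CommRing B] [IsDomain B] (φ : MvPolynomial (Fin 4) K →+* B)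
    (hJ : ∀ α : Fin 4 →₀ ℕ, 0 < α.degree → α.degree < q → φ (hasseDeriv α F) = 0)
    (h0 : ∀ g : MvPolynomial (Fin 4) K, φ g = 0 → MvPolynomial.eval (0 : Fin 4 → K) g = 0)
    (V : Finset (Fin 4)) (hV : ∀ i : Fin 4, i ∉ V → φ (X i) ≠ 0)
    (α : Fin 4 →₀ ℕ) (hα0 : 0 < α.degree) (hαq : α.degree < q) (a : Fin 4 → K)
    (haV : ∀ i ∈ V, a i = 0) (hne : MvPolynomial.eval a (hasseDeriv α F) ≠ 0) :
    ¬ InCoordinateScope q F := by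
  refine not_inCoordinateScope_of_prime (P := RingHom.ker φ) (RingHom.ker_isPrime φ) ?_ ?_ V ?_
    (not_le_span_X_image_of_eval V α hα0 hαq a haV hne)
  · unfold singLocusIdeal
    rw [Ideal.span_le]
    rintro _ ⟨β, hβ0, hβq, rfl⟩
    exact (RingHom.mem_ker).mpr (hJ β hβ0 hβq)
  · intro g hg
    unfold originIdeal
    exact (RingHom.mem_ker).mpr (h0 g ((RingHom.mem_ker).mp hg))
  · intro i hi
    by_contra hiV
    exact hV i hiV ((RingHom.mem_ker).mp hi)

/-! ## §2 `q = 2`: line and branch conveniences -/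

/-- **`q = 2` LINE blindness certificate**: the four partials vanish on the line `t ↦ t·v`, `vᵢ ≠ 0` off
`V`, and some `∂ₖF` not vanishing at a point `a` with `a|_V = 0`. OURS (elementary).
[cite: Giraud1975, §1 (Hasse–Schmidt derivations)] -/
theorem not_inCoordinateScope_two_of_line {K : Type} [Field K] {F : MvPolynomial (Fin 4) K}
    (v : Fin 4 → K) (V : Finset (Fin 4)) (hV : ∀ i : Fin 4, i ∉ V → v i ≠ 0)
    (hJ : ∀ k : Fin 4,
      MvPolynomial.aeval (fun k => Polynomial.C (v k) * Polynomial.X) (pderiv k F) = 0)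
    (k : Fin 4) (a : Fin 4 → K) (haV : ∀ i ∈ V, a i = 0)
    (hne : MvPolynomial.eval a (pderiv k F) ≠ 0) : ¬ InCoordinateScope 2 F := by
  refine not_inCoordinateScope_of_ringHom
    (MvPolynomial.aeval (fun k => Polynomial.C (v k) * Polynomial.X) :
      MvPolynomial (Fin 4) K →ₐ[K] Polynomial K).toRingHom (fun α h0 h2 => ?_) (fun g hg => ?_) V
    (fun i hi => ?_) (Finsupp.single k 1) (by rw [Finsupp.degree_single]; exact Nat.one_pos)
    (by rw [Finsupp.degree_single]; exact Nat.lt_succ_self 1) a haV (by rwa [hasseDeriv_single_one])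
  · obtain ⟨j, rfl⟩ := exists_eq_single_of_degree_eq_one (γ := α) (by omega)
    change MvPolynomial.aeval _ (hasseDeriv (Finsupp.single j 1) F) = 0
    rw [hasseDeriv_single_one]
    exact hJ j
  · rw [← eval_zero_aeval_line v g,
      show MvPolynomial.aeval (fun k => Polynomial.C (v k) * Polynomial.X) g = 0 from hg,
      Polynomial.eval_zero]
  · change MvPolynomial.aeval (fun k => Polynomial.C (v k) * Polynomial.X)
      (X i : MvPolynomial (Fin 4) K) ≠ 0
    rw [MvPolynomial.aeval_X]
    exact mul_ne_zero (Polynomial.C_ne_zero.mpr (hV i hi)) Polynomial.X_ne_zero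

/-- **`q = 2` BRANCH blindness certificate**: the four partials vanish along a branch `c ∈ K⟦t⟧⁴` through
`0`, `cᵢ ≠ 0` off `V`, and some `∂ₖF` not vanishing at a point `a` with `a|_V = 0`. OURS (elementary).
[cite: Giraud1975, §1 (Hasse–Schmidt derivations)] -/
theorem not_inCoordinateScope_two_of_powerSeriesCurve {K : Type} [Field K] {F : MvPolynomial (Fin 4) K}
    (c : Fin 4 → PowerSeries K) (hc : ∀ k, PowerSeries.constantCoeff (c k) = 0) (V : Finset (Fin 4))
    (hV : ∀ i : Fin 4, i ∉ V → c i ≠ 0)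
    (hJ : ∀ k : Fin 4, MvPolynomial.aeval c (pderiv k F) = 0)
    (k : Fin 4) (a : Fin 4 → K) (haV : ∀ i ∈ V, a i = 0)
    (hne : MvPolynomial.eval a (pderiv k F) ≠ 0) : ¬ InCoordinateScope 2 F := by
  refine not_inCoordinateScope_of_ringHom
    (MvPolynomial.aeval c : MvPolynomial (Fin 4) K →ₐ[K] PowerSeries K).toRingHom
    (fun α h0 h2 => ?_) (fun g hg => ?_) V (fun i hi => ?_) (Finsupp.single k 1)
    (by rw [Finsupp.degree_single]; exact Nat.one_pos)
    (by rw [Finsupp.degree_single]; exact Nat.lt_succ_self 1) a haV (by rwa [hasseDeriv_single_one])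
  · obtain ⟨j, rfl⟩ := exists_eq_single_of_degree_eq_one (γ := α) (by omega)
    change MvPolynomial.aeval _ (hasseDeriv (Finsupp.single j 1) F) = 0
    rw [hasseDeriv_single_one]
    exact hJ j
  · rw [← constantCoeff_aeval_curve c hc g, show MvPolynomial.aeval c g = 0 from hg, map_zero]
  · change MvPolynomial.aeval c (X i : MvPolynomial (Fin 4) K) ≠ 0
    rw [MvPolynomial.aeval_X]
    exact hV i hi

/-! ## §3 The cell's three blind specimens -/

/-- **T-001 (TRAP-1's `s₀`) is BLIND**: `F = x₃x₄ + x₂x₃ + x₂x₃x₄ + x₁²x₂ + x₁²x₂³` has a non-coordinate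
minimal prime of `J₂⁺(F)` inside `𝔪₀` — `¬ InCoordinateScope 2 F` over every field (branch
`x₂ = t, x₄ = −t(1+t)⁻¹, x₁ = x₃ = 0`; `V = {x₁, x₃}`; `∂₃F ∋` the monomial `x₄`). K-S2-1's mechanism
(WORD #20 (a)–(b)) as a kernel fact of the Scope vocabulary. OURS (‖ K; census value).
[cite: Giraud1975, §1 (Hasse–Schmidt derivations)] -/
theorem not_inCoordinateScope_two_trap1 {K : Type} [Field K] :
    ¬ InCoordinateScope 2 (X 2 * X 3 + X 1 * X 2 + X 1 * X 2 * X 3 + X 0 ^ 2 * X 1 + X 0 ^ 2 * X 1 ^ 3 :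
      MvPolynomial (Fin 4) K) := by
  have h1t : PowerSeries.constantCoeff (1 + PowerSeries.X : PowerSeries K) ≠ 0 := by simp
  have hut : (-PowerSeries.X * (1 + PowerSeries.X)⁻¹ : PowerSeries K) * (1 + PowerSeries.X) =
      -PowerSeries.X := by
    rw [mul_assoc, PowerSeries.inv_mul_cancel _ h1t, mul_one]
  have hu0 : (-PowerSeries.X * (1 + PowerSeries.X)⁻¹ : PowerSeries K) ≠ 0 := by
    intro h
    rw [h, zero_mul] at hut
    exact PowerSeries.X_ne_zero (neg_eq_zero.mp hut.symm)
  refine not_inCoordinateScope_two_of_powerSeriesCurve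
    (fun k => if k = 1 then PowerSeries.X else
      if k = 3 then -PowerSeries.X * (1 + PowerSeries.X)⁻¹ else 0) (fun k => ?_) {0, 2} (fun i hi => ?_)
    (fun k => ?_) 2 (fun k => if k = 3 then 1 else 0) (fun i hi => ?_) ?_
  · fin_cases k <;> simp
  · fin_cases i <;> simp_all
  · fin_cases k
    all_goals simp [map_add, map_mul, (pderiv _).leibniz_pow, pderiv_X]
    linear_combination hut
  · fin_cases i <;> simp_all
  · simp [map_add, map_mul, (pderiv _).leibniz_pow, pderiv_X]

/-- **T-002 (the reduction F₃) is BLIND**: `F₃ = x₃x₄ + x₂x₃ + x₂x₃x₄` — `¬ InCoordinateScope 2 F₃` over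
every field (branch `x₁ = x₂ = t, x₃ = 0, x₄ = −t(1+t)⁻¹`; `V = {x₃}`; `∂₃F₃ ∋ x₄`): the `q`-fold locus
through `0` is the regular NON-coordinate surface `{x₃ = 0, (1+x₂)(1+x₄) = 1}` (WORD #20 (b)).
OURS (‖ K; census value). [cite: Giraud1975, §1 (Hasse–Schmidt derivations)] -/
theorem not_inCoordinateScope_two_trapF3 {K : Type} [Field K] :
    ¬ InCoordinateScope 2 (X 2 * X 3 + X 1 * X 2 + X 1 * X 2 * X 3 : MvPolynomial (Fin 4) K) := by
  have h1t : PowerSeries.constantCoeff (1 + PowerSeries.X : PowerSeries K) ≠ 0 := by simp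
  have hut : (-PowerSeries.X * (1 + PowerSeries.X)⁻¹ : PowerSeries K) * (1 + PowerSeries.X) =
      -PowerSeries.X := by
    rw [mul_assoc, PowerSeries.inv_mul_cancel _ h1t, mul_one]
  have hu0 : (-PowerSeries.X * (1 + PowerSeries.X)⁻¹ : PowerSeries K) ≠ 0 := by
    intro h
    rw [h, zero_mul] at hut
    exact PowerSeries.X_ne_zero (neg_eq_zero.mp hut.symm)
  refine not_inCoordinateScope_two_of_powerSeriesCurve
    (fun k => if k = 2 then 0 else if k = 3 then -PowerSeries.X * (1 + PowerSeries.X)⁻¹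
      else PowerSeries.X) (fun k => ?_) {2} (fun i hi => ?_) (fun k => ?_) 2
    (fun k => if k = 3 then 1 else 0) (fun i hi => ?_) ?_
  · fin_cases k <;> simp
  · fin_cases i <;> simp_all
  · fin_cases k
    all_goals simp [map_add, map_mul, pderiv_X]
    all_goals linear_combination hut
  · fin_cases i <;> simp_all
  · simp [map_add, map_mul, pderiv_X]

/-- **idea-3's T-ISO-1 specimen is BLIND**: `F = x₁x₂ + x₁x₃ + x₂x₃ + x₄³` over a field of
characteristic `2` — `¬ InCoordinateScope 2 F` (line `(t,t,t,0)`; `V = {x₄}`; `∂₁F = x₂ + x₃ ∌` any `x₄`).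
OURS (‖ K; census value). [cite: Giraud1975, §1 (Hasse–Schmidt derivations)] -/
theorem not_inCoordinateScope_two_idea3Specimen {K : Type} [Field K] [CharP K 2] :
    ¬ InCoordinateScope 2 (X 0 * X 1 + X 0 * X 2 + X 1 * X 2 + X 3 ^ 3 : MvPolynomial (Fin 4) K) := by
  have h2 : ∀ P : Polynomial K, P + P = 0 := fun P => CharTwo.add_self_eq_zero P
  refine not_inCoordinateScope_two_of_line (fun k => if k = 3 then 0 else 1) {3} (fun i hi => ?_)
    (fun k => ?_) 0 (fun k => if k = 1 then 1 else 0) (fun i hi => ?_) ?_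
  · fin_cases i <;> simp_all
  · fin_cases k <;> simp [map_add, map_mul, (pderiv _).leibniz_pow, pderiv_X, h2]
  · fin_cases i <;> simp_all
  · simp [map_add, (pderiv _).leibniz_pow, pderiv_X]

end Summit.ResolutionOfSingularities.ResolutionOfSingularities.Theorems.PIDim4.IsolationCert

end
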